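import Summits.AtomisticToContinuum.Crystallization.Theorems.FrustratedLawDichotomyStrainedPatchHomEntryTableP

/-!
# The fcc verdict of record in CHEAP-FIRST ORDER: `entryLeafOK6Q = entryLeafOK6RBKP` as functions (same disjuncts, reordered)

decomp-a2c hand-1 g24 (crux `AperiodicFrustratedLawGap`, stmt-AtomisticToContinuum-27623).  MEASURED natively on a failing interior node (pilot box B,
hand-1 g24 P17): `radOK` 93 ms, `signOut`/`domOut` ≈ 0, `tableLeafOKP` 36 ms, `tableLeafOKK` 11 ms, `entryLeafOKB` 93 ms (fitOK3 8 + fitOK2 34 + fitOK 36 + record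
table).  The certificate verdict `…HomEntryTableP.entryLeafOK6RBKP μ c w = radOK … || (signOut || domOut || (tableLeafOKP || (entryLeafOKB || tableLeafOKK)))`
tries the most expensive and least frequently firing disjunct FIRST, so every accepted leaf pays 93 ms before anything else.  In the TREE currency
(`…HomEntryTreeShard`: `treeOK` evaluates the verdict at accepting leaves only) the evaluation order is the whole cost: with the census class mix
(TAB 8.2e5 · FIT 4.7e5 · DOM 2.8e5 · BALL 1.0e5 leaves) the order sign/dom → table P → tiers K → fits/record → radial LAST costs ≈ ×2 less.

* `entryLeafOK6Q μ c w := signOut ∨ domOut ∨ tableLeafOKP ∨ tableLeafOKK ∨ entryLeafOKB (all on the symmetrised box) ∨ radOK (mirror)`;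
* ★ `entryLeafOK6Q_eq : entryLeafOK6Q = entryLeafOK6RBKP` (Boolean AC, by cases) — so EVERY theorem about the verdict of record transfers by `rw`:
  `treeOK_6Q`, `searchOK_6Q`, `searchLeaves_6Q` (identical trees, Booleans and counts), `exists_tree_6RBKP_of_6Q` (a root ∃-tree fact computed with the
  quick verdict IS the `hF` of `…HomEntryTreeCert.homFloor_625_of_entryTrees6RBKP_HVK` after one rewrite).

Computable; 0 sorry; standard axioms; no instances / notation / `#eval`.  `--supports stmt-AtomisticToContinuum-27623`.
-/

namespace Summit.AtomisticToContinuum.Crystallization.Theorems.FrustratedLawDichotomyStrainedPatchHomEntryQuick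

open Summit.AtomisticToContinuum.Crystallization.Theorems.FrustratedLawDichotomyStrainedPatchHomCertTree (CertTree treeOK)
open Summit.AtomisticToContinuum.Crystallization.Theorems.FrustratedLawDichotomyStrainedPatchHomEntrySearch (searchOK searchLeaves)
open Summit.AtomisticToContinuum.Crystallization.Theorems.FrustratedLawDichotomyStrainedPatchHomEntrySym (domOut)
open Summit.AtomisticToContinuum.Crystallization.Theorems.FrustratedLawDichotomyStrainedPatchHomEntrySign (signOut)
open Summit.AtomisticToContinuum.Crystallization.Theorems.FrustratedLawDichotomyStrainedPatchHomEntrySix (symIdx)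
open Summit.AtomisticToContinuum.Crystallization.Theorems.FrustratedLawDichotomyStrainedPatchHomEntryRadial (radOK)
open Summit.AtomisticToContinuum.Crystallization.Theorems.FrustratedLawDichotomyStrainedPatchHomEntrySymBox (symU)
open Summit.AtomisticToContinuum.Crystallization.Theorems.FrustratedLawDichotomyStrainedPatchHomEntryBest (entryLeafOKB)
open Summit.AtomisticToContinuum.Crystallization.Theorems.FrustratedLawDichotomyStrainedPatchHomEntryTableK (tableLeafOKK entryLeafOKBK)
open Summit.AtomisticToContinuum.Crystallization.Theorems.FrustratedLawDichotomyStrainedPatchHomEntryTableP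

/-- ★ **THE fcc VERDICT OF RECORD, CHEAP-FIRST**: sign/sorted-diagonal prunes (free) → param table (36 ms) → tiers K (11 ms) → fits + record table (≈ 90 ms) →
radial-bad prune LAST (93 ms).  Same six disjuncts as `entryLeafOK6RBKP μ c w`. -/
def entryLeafOK6Q (μ : ℤ) (c w : Fin 3 × Fin 3 → ℤ) : Bool :=
  signOut (symU c) (symU w) || domOut (symU c) (symU w) || tableLeafOKP μ (symU c) (symU w) || tableLeafOKK μ (symU c) (symU w) ||
    entryLeafOKB μ (symU c) (symU w) || radOK (c ∘ symIdx) (w ∘ symIdx)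

/-- Pointwise: the reordered verdict IS the verdict of record (Boolean associativity/commutativity, by cases on the six atoms). [formal bookkeeping] -/
theorem entryLeafOK6Q_apply (μ : ℤ) (c w : Fin 3 × Fin 3 → ℤ) : entryLeafOK6Q μ c w = entryLeafOK6RBKP μ c w := by
  unfold entryLeafOK6Q entryLeafOK6RBKP entryLeafOKDBsKP entryLeafOKDBKP entryLeafOKBKP
  unfold entryLeafOKBK
  generalize radOK (c ∘ symIdx) (w ∘ symIdx) = r
  generalize signOut (symU c) (symU w) = s
  generalize domOut (symU c) (symU w) = d
  generalize tableLeafOKP μ (symU c) (symU w) = p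
  generalize tableLeafOKK μ (symU c) (symU w) = k
  generalize entryLeafOKB μ (symU c) (symU w) = b
  cases r <;> cases s <;> cases d <;> cases p <;> cases k <;> cases b <;> rfl

/-- ★ **`entryLeafOK6Q = entryLeafOK6RBKP`** as functions of `(μ, c, w)`. [formal bookkeeping] -/
theorem entryLeafOK6Q_eq : entryLeafOK6Q = entryLeafOK6RBKP :=
  funext fun μ => funext fun c => funext fun w => entryLeafOK6Q_apply μ c w

/-- Certificate trees: identical verdicts at every leaf. [formal bookkeeping] -/
theorem treeOK_6Q (μ : ℤ) (t : CertTree (Fin 3 × Fin 3)) (c w : Fin 3 × Fin 3 → ℤ) :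
    treeOK (entryLeafOK6Q μ) t c w = treeOK (entryLeafOK6RBKP μ) t c w := by
  rw [entryLeafOK6Q_eq]

/-- Search Booleans: identical. [formal bookkeeping] -/
theorem searchOK_6Q (μ : ℤ) (sel : ℕ → (Fin 3 × Fin 3 → ℤ) → (Fin 3 × Fin 3 → ℤ) → Fin 3 × Fin 3) (fuel d : ℕ) (c w : Fin 3 × Fin 3 → ℤ) :
    searchOK (entryLeafOK6Q μ) sel fuel d c w = searchOK (entryLeafOK6RBKP μ) sel fuel d c w := by
  rw [entryLeafOK6Q_eq]

/-- Leaf counts: identical (so census counts taken with the quick verdict size the certificate of record exactly). [formal bookkeeping] -/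
theorem searchLeaves_6Q (μ : ℤ) (sel : ℕ → (Fin 3 × Fin 3 → ℤ) → (Fin 3 × Fin 3 → ℤ) → Fin 3 × Fin 3) (fuel d : ℕ) (c w : Fin 3 × Fin 3 → ℤ) :
    searchLeaves (entryLeafOK6Q μ) sel fuel d c w = searchLeaves (entryLeafOK6RBKP μ) sel fuel d c w := by
  rw [entryLeafOK6Q_eq]

/-- ★ A root (or shard) ∃-tree fact computed with the QUICK verdict is one for the verdict of record — the `hF` of
`…HomEntryTreeCert.homFloor_625_of_entryTrees6RBKP_HVK` when `(c, w) = (rootC, rootW)` and `μ = muRec`. [formal bookkeeping] -/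
theorem exists_tree_6RBKP_of_6Q {μ : ℤ} {c w : Fin 3 × Fin 3 → ℤ} (h : ∃ t : CertTree (Fin 3 × Fin 3), treeOK (entryLeafOK6Q μ) t c w = true) :
    ∃ t : CertTree (Fin 3 × Fin 3), treeOK (entryLeafOK6RBKP μ) t c w = true := by
  obtain ⟨t, ht⟩ := h
  exact ⟨t, by rw [← treeOK_6Q]; exact ht⟩

/-- … and conversely. [formal bookkeeping] -/
theorem exists_tree_6Q_of_6RBKP {μ : ℤ} {c w : Fin 3 × Fin 3 → ℤ} (h : ∃ t : CertTree (Fin 3 × Fin 3), treeOK (entryLeafOK6RBKP μ) t c w = true) :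
    ∃ t : CertTree (Fin 3 × Fin 3), treeOK (entryLeafOK6Q μ) t c w = true := by
  obtain ⟨t, ht⟩ := h
  exact ⟨t, by rw [treeOK_6Q]; exact ht⟩

/-! ## §2. VERDICT MONOTONICITY (appended, hand-1 g24; critic row 927 (iii)(b)): a certificate computed with any verdict `v'` that IMPLIES `v`
pointwise is a certificate for `v` — so GATED / pruned-down verdicts (cheaper at failing nodes) may generate and even certify the trees, and the
result transfers to the verdict of record without re-evaluation. -/

/-- ★ Trees: a pointwise weaker-or-equal verdict's certificate tree is a certificate tree for the stronger verdict. [formal bookkeeping] -/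
theorem treeOK_of_imp {κ : Type} [DecidableEq κ] {v v' : (κ → ℤ) → (κ → ℤ) → Bool} (himp : ∀ c w, v' c w = true → v c w = true) :
    ∀ (t : CertTree κ) (c w : κ → ℤ), treeOK v' t c w = true → treeOK v t c w = true
  | .leaf, c, w, h => by
    simp only [treeOK] at h ⊢
    exact himp c w h
  | .split k l r, c, w, h => by
    simp only [treeOK, Bool.and_eq_true, decide_eq_true_eq] at h ⊢
    exact ⟨⟨h.1.1, treeOK_of_imp himp l _ _ h.1.2⟩, treeOK_of_imp himp r _ _ h.2⟩

/-- ★ ∃-tree facts transfer along a pointwise implication of verdicts. [formal bookkeeping] -/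
theorem exists_tree_of_imp {κ : Type} [DecidableEq κ] {v v' : (κ → ℤ) → (κ → ℤ) → Bool} (himp : ∀ c w, v' c w = true → v c w = true) {c w : κ → ℤ}
    (h : ∃ t : CertTree κ, treeOK v' t c w = true) : ∃ t : CertTree κ, treeOK v t c w = true := by
  obtain ⟨t, ht⟩ := h
  exact ⟨t, treeOK_of_imp himp t c w ht⟩

/-- ★ Search Booleans transfer along a pointwise implication of verdicts (same selector, fuel, depth, box). [formal bookkeeping] -/
theorem searchOK_of_imp {κ : Type} [DecidableEq κ] {v v' : (κ → ℤ) → (κ → ℤ) → Bool} (himp : ∀ c w, v' c w = true → v c w = true)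
    (sel : ℕ → (κ → ℤ) → (κ → ℤ) → κ) : ∀ (fuel d : ℕ) (c w : κ → ℤ), searchOK v' sel fuel d c w = true → searchOK v sel fuel d c w = true
  | 0, d, c, w, h => by
    rw [searchOK] at h ⊢
    exact himp c w h
  | n + 1, d, c, w, h => by
    rw [searchOK] at h ⊢
    simp only [Bool.or_eq_true, Bool.and_eq_true, decide_eq_true_eq] at h ⊢
    rcases h with h | ⟨⟨hev, hl⟩, hr⟩
    · exact Or.inl (himp c w h)
    · exact Or.inr ⟨⟨hev, searchOK_of_imp himp sel n _ _ _ hl⟩, searchOK_of_imp himp sel n _ _ _ hr⟩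

/-- Example of use: the quick verdict implies the verdict of record (they are equal), so `exists_tree_of_imp` recovers `exists_tree_6RBKP_of_6Q`. [formal bookkeeping] -/
theorem entryLeafOK6Q_imp (μ : ℤ) (c w : Fin 3 × Fin 3 → ℤ) (h : entryLeafOK6Q μ c w = true) : entryLeafOK6RBKP μ c w = true := by
  rwa [entryLeafOK6Q_apply] at h

/-! ## §3. FIT-FIRST ORDER for critical-layer shards (appended, hand-1 g24)

MEASURED (kernel, Cert_CalLayer64K): an 849-leaf critical-layer tree (leaves accepted by the FIT prunes at 2⁻⁹/2⁻¹⁰) does not finish in 1750 s even in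
≤ 64-leaf theorems with `entryLeafOK6Q` (> 2 s/leaf: every leaf first fails the four param tiers and the K tiers), while bulk/far table leaves cost
0.7–0.9 s.  The same six disjuncts with the FITS FIRST serve the layer; the generator picks the order per shard (both orders are the record verdict). -/

/-- ★ The fcc verdict of record, FIT-FIRST: sign/dom → fits + record table (`entryLeafOKB`) → param table → tiers K → radial last. -/
def entryLeafOK6F (μ : ℤ) (c w : Fin 3 × Fin 3 → ℤ) : Bool :=
  signOut (symU c) (symU w) || domOut (symU c) (symU w) || entryLeafOKB μ (symU c) (symU w) || tableLeafOKP μ (symU c) (symU w) ||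
    tableLeafOKK μ (symU c) (symU w) || radOK (c ∘ symIdx) (w ∘ symIdx)

/-- Pointwise: the fit-first verdict IS the verdict of record. [formal bookkeeping] -/
theorem entryLeafOK6F_apply (μ : ℤ) (c w : Fin 3 × Fin 3 → ℤ) : entryLeafOK6F μ c w = entryLeafOK6RBKP μ c w := by
  rw [← entryLeafOK6Q_apply]
  unfold entryLeafOK6F entryLeafOK6Q
  generalize radOK (c ∘ symIdx) (w ∘ symIdx) = r
  generalize signOut (symU c) (symU w) = s
  generalize domOut (symU c) (symU w) = d
  generalize tableLeafOKP μ (symU c) (symU w) = p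
  generalize tableLeafOKK μ (symU c) (symU w) = k
  generalize entryLeafOKB μ (symU c) (symU w) = b
  cases r <;> cases s <;> cases d <;> cases p <;> cases k <;> cases b <;> rfl

/-- `entryLeafOK6F = entryLeafOK6RBKP` as functions. [formal bookkeeping] -/
theorem entryLeafOK6F_eq : entryLeafOK6F = entryLeafOK6RBKP :=
  funext fun μ => funext fun c => funext fun w => entryLeafOK6F_apply μ c w

/-- ∃-tree facts computed with the fit-first verdict are facts for the verdict of record. [formal bookkeeping] -/
theorem exists_tree_6RBKP_of_6F {μ : ℤ} {c w : Fin 3 × Fin 3 → ℤ} (h : ∃ t : CertTree (Fin 3 × Fin 3), treeOK (entryLeafOK6F μ) t c w = true) :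
    ∃ t : CertTree (Fin 3 × Fin 3), treeOK (entryLeafOK6RBKP μ) t c w = true := by
  obtain ⟨t, ht⟩ := h
  exact ⟨t, by rw [← entryLeafOK6F_eq]; exact ht⟩

/-- … and they convert to the quick-order currency too (so shards of either order glue in ONE tree of `entryLeafOK6Q` facts). [formal bookkeeping] -/
theorem exists_tree_6Q_of_6F {μ : ℤ} {c w : Fin 3 × Fin 3 → ℤ} (h : ∃ t : CertTree (Fin 3 × Fin 3), treeOK (entryLeafOK6F μ) t c w = true) :
    ∃ t : CertTree (Fin 3 × Fin 3), treeOK (entryLeafOK6Q μ) t c w = true := by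
  obtain ⟨t, ht⟩ := h
  exact ⟨t, by rw [entryLeafOK6Q_eq, ← entryLeafOK6F_eq]; exact ht⟩

end Summit.AtomisticToContinuum.Crystallization.Theorems.FrustratedLawDichotomyStrainedPatchHomEntryQuick
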